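import Mathlib.CategoryTheory.SingleObj
import Mathlib.CategoryTheory.Groupoid
import Mathlib.CategoryTheory.Discrete.Basic
import Mathlib.CategoryTheory.Functor.Const
import Mathlib.Algebra.Ring.CharZero
import Literature.IUT.LogThetaLattice.BiCores
import Literature.IUT.LogThetaLattice.HodgeTheaterLogLink
import Literature.IUT.LogThetaLattice.LatticeGlue
import HarnessLib

/-!
# Non-vacuity and independence witnesses for the [IUTchIII] §1–§2 interfaces
# (`StripFrame`, `LogStripData`, `ThetaLinkData`, `LogThetaLatticeDiagram`, `BiCoricData`; v2: `ThetaMonoidData`,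
# `ThetaCoricData`, `LatticeGlue`)

Mochizuki, *Inter-universal Teichmüller Theory III*, kurims manuscript (May 2020), §1
[cite: Mochizuki2012, III Def 1.1 p.23, Def 1.4 p.45, Thm 1.5 (iii)–(v) pp.48–51] (D-0012 claim key,
status disputed). This is a WITNESS file (kernel-checked models), written by the owner of the interfaces
(abc-iut-L6-t3): it asserts nothing about the mathematics of [IUTchIII]; it records that

1. the interface LAWS of `StripFrame` (`PrimeStripFrame.lean`), `LogStripData` (`LogLink.lean`),
   `ThetaLinkData` / `LogThetaLatticeDiagram` (`HodgeTheaterLogLink.lean`) and `BiCoricData`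
   (`BiCores.lean`) are JOINTLY SATISFIABLE — the model `twoFrame` below inhabits all of them at once
   (the review of p406839 checked a `PUnit` model in scratch; this lands a model in the tree), so no
   theorem proved "for every `S`, `B`" in those files is vacuously true for want of an instance;
2. in that model the VERTICAL poly-isomorphism of Thm 1.5 (iii) is a PROPER subset of the horizontal one
   (`two_vertical_ssubset_horizontal`): the printed "in general, strictly smaller" (p.49) is realizable
   over the interface and `BiCoricData.verticalPolyIso_subset` is not secretly an equality;
3. in that model the poly-isomorphism of `D^⊩`-data induced by the full poly-isomorphism of
   `D^⊢`-prime-strips (Thm 1.5 (v), `BiCoricData.biCoricRealifiedPolyIso`) has TWO distinct constituents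
   (`two_biCoricRealifiedPolyIso_not_subsingleton`), while in the variant `twoBiCoricRigid` it is a
   subsingleton (`twoRigid_biCoricRealifiedPolyIso_subsingleton`): the singular "AN isomorphism" of
   Thm 1.5 (v) / [IUTchII] Cor 4.10 (v) — typed as a named `Prop` in `BiCoresRealified.lean` — is
   INDEPENDENT of the remaining interface laws (neither automatic nor contradictory), i.e. it is genuine
   content that the [IUTchII] Cor 4.5 (ii) construction `D^⊩(−)` must supply.

The model: every prime-strip category is the one-object groupoid on the group `ℤˣ = {±1}`
(`CategoryTheory.SingleObj ℤˣ`), Hodge theaters are `Discrete (ℤ × ℤ)` (so that a log-theta-lattice of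
DISTINCT Hodge theaters exists), `D`-Hodge theaters are `Discrete PUnit`, all functors are identities or
constant, every poly-isomorphism datum is the full one. Universe `0`.

v2 (append-only): 4. the §2 interfaces `ThetaMonoidData` (`ThetaMonoids.lean`), `ThetaCoricData`
(`RadialData.lean`) and the glue `LatticeGlue` (`LatticeGlue.lean`, all identification isomorphisms
identities) are inhabited over the SAME frame (`twoThetaMonoid`, `twoCoric`, `twoGlue`) — so the whole
[IUTchIII] §1–§2 interface stack, glue laws included, is jointly satisfiable.
-/

namespace Literature.IUT.LogThetaLattice

open CategoryTheory
open Literature.IUT.HodgeTheaters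

namespace Witness

/-- **IUTchIII:Def1.1** (kurims p.23) the one-object groupoid on `ℤˣ = {±1}` used for every prime-strip category of the witness
frame. [claim: Mochizuki2012, status: disputed] -/
abbrev Pt : Type := SingleObj ℤˣ

/-- **IUTchIII:Def1.1** (kurims p.23) its object. [claim: Mochizuki2012, status: disputed] -/
abbrev pt : Pt := SingleObj.star ℤˣ

/-- **IUTchIII:Def1.1** (kurims p.23) all objects of `Pt` are `pt`. [claim: Mochizuki2012, status: disputed] -/
theorem eq_pt (X : Pt) : X = pt := rfl

/-- **IUTchIII:Def1.1** (kurims p.23) the constant functor at `pt`. [claim: Mochizuki2012, status: disputed] -/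
abbrev toPt (C : Type) [Category.{0} C] : C ⥤ Pt := (Functor.const C).obj pt

/-- **IUTchIII:Def1.1** (kurims p.23) the identity functor of `Pt` is bijective on isomorphisms.
[claim: Mochizuki2012, status: disputed] -/
theorem id_mapIso_bijective (X Y : Pt) : Function.Bijective (fun f : X ≅ Y => (𝟭 Pt).mapIso f) := by
  constructor
  · intro f g h
    exact Iso.ext (congrArg Iso.hom h)
  · intro e
    exact ⟨e, Iso.ext rfl⟩

/-- **IUTchIII:Def1.1** (kurims p.23) THE WITNESS FRAME: every prime-strip category is `Pt`, Hodge theaters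
`Discrete (ℤ × ℤ)`, `D`-Hodge theaters `Discrete PUnit`, all structure functors identities / constant.
[claim: Mochizuki2012, status: disputed] -/
noncomputable def twoFrame : StripFrame.{0} where
  F := Pt
  Fv := Pt
  Fxm := Pt
  Fvtxm := Pt
  Fgl := Pt
  Fglxm := Pt
  D := Pt
  Dv := Pt
  HT := Discrete (ℤ × ℤ)
  DHT := Discrete PUnit
  toD := 𝟭 Pt
  toFv := 𝟭 Pt
  FvToDv := 𝟭 Pt
  DToDv := 𝟭 Pt
  FvToFxm := 𝟭 Pt
  FxmToDv := 𝟭 Pt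
  FglToFv := 𝟭 Pt
  FglToFglxm := 𝟭 Pt
  FglxmToFvtxm := 𝟭 Pt
  FvtxmToFxm := 𝟭 Pt
  toDv_comm := Iso.refl _
  fxm_comm := Iso.refl _
  htToD := (Functor.const _).obj ⟨PUnit.unit⟩
  Label := PUnit
  strip _ := toPt _
  dstrip _ := toPt _
  strip_comm _ := Iso.refl _
  toD_isoBij := id_mapIso_bijective
  toDv_isoSurj X Y := (id_mapIso_bijective X Y).2
  iso_nonempty_F _ _ := ⟨Iso.refl _⟩
  iso_nonempty_Fxm _ _ := ⟨Iso.refl _⟩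
  iso_nonempty_Fglxm _ _ := ⟨Iso.refl _⟩
  iso_nonempty_DHT X Y := ⟨eqToIso (Subsingleton.elim X Y)⟩

/-- **IUTchIII:Def1.1(iii)** (kurims p.26) `LogStripData` is inhabited over the witness frame (`log := 𝟭`).
[claim: Mochizuki2012, status: disputed] -/
noncomputable def twoLog : LogStripData twoFrame where
  log := 𝟭 Pt
  logD := Iso.refl _

/-- **IUTchII:Cor4.10(iii)** (kurims p.160) `ThetaLinkData` is inhabited over the witness frame (all pilot strips
constant; the induced poly-isomorphism of `F^{⊢×μ}`-prime-strips is full because the structure functor is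
the identity). [claim: Mochizuki2012, status: disputed] -/
noncomputable def twoTheta : ThetaLinkData twoFrame where
  pilotDelta := toPt _
  pilotTheta _ := toPt _
  unitPortion _ := Iso.refl _
  induced_full _ _ _ :=
    PolyIso.map_full_of_fullyFaithful (Functor.FullyFaithful.id Pt) _ _

/-- **IUTchIII:Def1.4** (kurims p.45) a (Gaussian) log-theta-lattice of DISTINCT Hodge theaters exists over the
witness frame. [claim: Mochizuki2012, status: disputed] -/
noncomputable def twoLattice : LogThetaLatticeDiagram twoLog twoTheta where
  kind := LatticeKind.gaussian
  HT p := ⟨p⟩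
  injective p q h := by simpa using congrArg Discrete.as h

/-- **IUTchIII:Def1.4** (kurims p.46) it is Gaussian. [claim: Mochizuki2012, status: disputed] -/
theorem twoLattice_isGaussian : twoLattice.IsGaussian := rfl

/-- **IUTchIII:Thm1.5(iii)** (kurims p.48) `BiCoricData` over the witness frame with a PARAMETRIC `D^⊩(−)`:
all shell functors identities, every orbit datum the FULL poly-isomorphism; the realified data
`(RFrob, realified, realifiedHT)` are arguments so that a rigid and a non-rigid `D^⊩(−)` can be compared.
[claim: Mochizuki2012, status: disputed] -/
noncomputable def mkBiCoric (R : Type) [Category.{0} R] (real : Pt ⥤ R)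
    (realHT : Discrete (ℤ × ℤ) ⥤ R) (k : ∀ X : Discrete (ℤ × ℤ), realHT.obj X ≅ real.obj pt) :
    BiCoricData twoFrame where
  Sh := Pt
  holShell := 𝟭 Pt
  fxmShell := 𝟭 Pt
  monoShell := 𝟭 Pt
  monoFxm _ := PolyIso.full _ _
  monoFxm_nonempty _ := ⟨Iso.refl _, PolyIso.mem_full _⟩
  monoFxm_map _ _ _ := PolyIso.mem_full _
  monoFxmOfF _ := PolyIso.full _ _
  monoFxmOfF_nonempty _ := ⟨Iso.refl _, PolyIso.mem_full _⟩
  monoFxmOfF_le _ := subset_rfl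
  fxmHol _ := PolyIso.full _ _
  fxmHol_nonempty _ := ⟨Iso.refl _, PolyIso.mem_full _⟩
  FofD := 𝟭 Pt
  FofD_D := Iso.refl _
  fxmOfDv := 𝟭 Pt
  fxmOfDv_dv := Iso.refl _
  dvDelta := toPt _
  succ := PUnit.unit
  fxOfDsucc := 𝟭 Pt
  fxOfDsucc_delta := Iso.refl _
  fxmDeltaHT := toPt _
  kummer := Iso.refl _
  RFrob := R
  realified := real
  realifiedHT := realHT
  realifiedKummer _ := PolyIso.full _ _
  realifiedKummer_nonempty X := ⟨k X, PolyIso.mem_full _⟩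

/-- **IUTchIII:Thm1.5(iii)** (kurims p.48) `BiCoricData` is inhabited over the witness frame, with `D^⊩(−) := 𝟭`
(NOT rigid, see below). [claim: Mochizuki2012, status: disputed] -/
noncomputable def twoBiCoric : BiCoricData twoFrame :=
  mkBiCoric Pt (𝟭 Pt) (toPt _) (fun _ => Iso.refl _)

/-- **IUTchIII:Thm1.5(v)** (kurims p.50) the RIGID variant: same data, but `D^⊩(−)` the constant functor to a
category with exactly one isomorphism. [claim: Mochizuki2012, status: disputed] -/
noncomputable def twoBiCoricRigid : BiCoricData twoFrame :=
  mkBiCoric (Discrete PUnit) ((Functor.const _).obj ⟨PUnit.unit⟩) ((Functor.const _).obj ⟨PUnit.unit⟩)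
    (fun _ => Iso.refl _)

/-- **IUTchIII:Thm1.5(iii)** (kurims p.49) the automorphism `−1` of the object of `Pt`. [claim: Mochizuki2012, status: disputed] -/
noncomputable def negIso : pt ≅ pt := (Groupoid.isoEquivHom pt pt).symm (-1 : ℤˣ)

/-- **IUTchIII:Thm1.5(iii)** (kurims p.49) its underlying morphism is `−1`. [claim: Mochizuki2012, status: disputed] -/
theorem negIso_hom : negIso.hom = (-1 : ℤˣ) := rfl

/-- **IUTchIII:Thm1.5(iii)** (kurims p.49) hence `negIso` is not the identity. [claim: Mochizuki2012, status: disputed] -/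
theorem negIso_ne_refl : negIso ≠ Iso.refl pt := by
  intro h
  exact (units_ne_neg_self (1 : ℤˣ)).symm (congrArg Iso.hom h)

variable (H H' : twoFrame.DHT)

/-- **IUTchIII:Thm1.5(iii)** (kurims p.49) in the witness, every constituent of the VERTICAL poly-isomorphism has
underlying morphism `1` (it is induced from the one isomorphism of `D`-Hodge theaters).
[claim: Mochizuki2012, status: disputed] -/
theorem two_hom_eq_one_of_mem_vertical {e : twoBiCoric.fxmDeltaOf H ≅ twoBiCoric.fxmDeltaOf H'}
    (he : e ∈ twoBiCoric.verticalPolyIso H H') : e.hom = (1 : ℤˣ) := by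
  obtain ⟨f, ⟨a, ha, g, ⟨ξ, -, rfl⟩, rfl⟩, c, hc, rfl⟩ := he
  rw [PolyIso.mem_single] at ha hc
  subst ha; subst hc
  rfl

/-- **IUTchIII:Thm1.5(iii)** (kurims p.49) in the witness, `negIso` is a constituent of the HORIZONTAL
poly-isomorphism (it is induced by an isomorphism of `D^⊢`-prime-strips). [claim: Mochizuki2012, status: disputed] -/
theorem two_negIso_mem_horizontal : negIso ∈ twoBiCoric.horizontalPolyIso H H' :=
  (twoBiCoric.mem_horizontalPolyIso H H' negIso).mpr ⟨negIso, Iso.ext rfl⟩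

/-- **IUTchIII:Thm1.5(iii)** (kurims p.49) … but not of the vertical one. [claim: Mochizuki2012, status: disputed] -/
theorem two_negIso_not_mem_vertical : negIso ∉ twoBiCoric.verticalPolyIso H H' := by
  intro h
  exact (units_ne_neg_self (1 : ℤˣ)).symm (two_hom_eq_one_of_mem_vertical H H' h)

/-- **IUTchIII:Thm1.5(iii)** (kurims p.49) WITNESS of "the collection of isomorphisms that constitute the
poly-isomorphisms … of the first line … is, in general, strictly smaller than [that] of the second line":
over the witness frame the vertical poly-isomorphism is a PROPER subset of the horizontal one — so
`BiCoricData.verticalPolyIso_subset` is sharp at the interface level. [claim: Mochizuki2012, status: disputed] -/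
theorem two_vertical_ssubset_horizontal :
    twoBiCoric.verticalPolyIso H H' ⊂ twoBiCoric.horizontalPolyIso H H' :=
  ⟨twoBiCoric.verticalPolyIso_subset H H',
    fun h => two_negIso_not_mem_vertical H H' (h (two_negIso_mem_horizontal H H'))⟩

/-- **IUTchIII:Thm1.5(v)** (kurims p.50) WITNESS: with `D^⊩(−) := 𝟭` the poly-isomorphism of `D^⊩`-data induced by
the full poly-isomorphism of `D^⊢`-prime-strips has the two DISTINCT constituents `1`, `−1` — the singular
"an isomorphism" of Thm 1.5 (v) / [IUTchII] Cor 4.10 (v) does NOT follow from the other interface laws.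
[claim: Mochizuki2012, status: disputed] -/
theorem two_biCoricRealifiedPolyIso_not_subsingleton :
    ¬ (twoBiCoric.biCoricRealifiedPolyIso H H').Subsingleton := by
  intro h
  have h1 : Iso.refl pt ∈ twoBiCoric.biCoricRealifiedPolyIso H H' :=
    ⟨Iso.refl pt, PolyIso.mem_full _, Iso.ext rfl⟩
  have h2 : negIso ∈ twoBiCoric.biCoricRealifiedPolyIso H H' :=
    ⟨negIso, PolyIso.mem_full _, Iso.ext rfl⟩
  exact negIso_ne_refl (h h2 h1)

/-- **IUTchIII:Thm1.5(v)** (kurims p.50) WITNESS: in the rigid variant the same poly-isomorphism IS a subsingleton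
— the singular "an isomorphism" is CONSISTENT with the other interface laws. Together with the previous
theorem: it is independent of them. [claim: Mochizuki2012, status: disputed] -/
theorem twoRigid_biCoricRealifiedPolyIso_subsingleton :
    (twoBiCoricRigid.biCoricRealifiedPolyIso H H').Subsingleton :=
  fun e _ e' _ => Iso.ext (Subsingleton.elim (α := (⟨PUnit.unit⟩ : Discrete PUnit) ⟶ ⟨PUnit.unit⟩) e.hom e'.hom)

/-- **IUTchIII:Thm1.5(iii)** (kurims p.50) the bi-coric poly-isomorphism of the witness lattice between any two
lattice points is nonempty (sanity: the composite vertical-then-horizontal class is inhabited).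
[claim: Mochizuki2012, status: disputed] -/
theorem two_biCoricPolyIso_nonempty (p q : ℤ × ℤ) :
    (twoBiCoric.biCoricPolyIso twoLattice.HT p q).Nonempty := by
  refine ⟨_, _, ⟨_, ⟨_, PolyIso.mem_single.mpr rfl, _,
    ⟨(twoFrame.iso_nonempty_DHT _ _).some, PolyIso.mem_full _, rfl⟩, rfl⟩, _, PolyIso.mem_single.mpr rfl, rfl⟩,
    _, (twoBiCoric.mem_horizontalPolyIso _ _ _).mpr ⟨Iso.refl _, rfl⟩, rfl⟩

/-! ### v2: the §2 interfaces and the glue over the witness frame -/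

/-- **IUTchIII:Prop2.1(ii)** (kurims p.58) `ThetaMonoidData` is inhabited over the witness frame: theta-monoid
and realified-Frobenioid categories `Pt`, étale-like functors identities, Frobenius-like functors
constant, all Kummer isomorphisms identities; Thm 2.2 (i)'s surjectivity holds for the identity functor.
[claim: Mochizuki2012, status: disputed] -/
noncomputable def twoThetaMonoid : ThetaMonoidData twoFrame where
  TM := Pt
  RF := Pt
  gt := PUnit.unit
  ΨenvD := 𝟭 Pt
  ΨenvInfD := 𝟭 Pt
  DglEnv := 𝟭 Pt
  ΨFenv := toPt _
  ΨFenvInf := toPt _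
  CglEnv := toPt _
  kummerΨ := Iso.refl _
  kummerΨInf := Iso.refl _
  kummerC := Iso.refl _
  FglEnvD := 𝟭 Pt
  FglEnvHT := toPt _
  kummerFgl := Iso.refl _
  fxmDeltaD := toPt _
  unitPortionD := Iso.refl _
  mapAut_surjective _ b := ⟨b, Iso.ext rfl⟩

/-- **IUTchIII:Cor2.3** (kurims p.72) `ThetaCoricData` is inhabited over the witness frame.
[claim: Mochizuki2012, status: disputed] -/
noncomputable def twoCoric : ThetaCoricData twoFrame where
  dvDelta := toPt _
  fxmOfDv := 𝟭 Pt
  fxmOfDv_dv := Iso.refl _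
  fglEnv := toPt _
  Rbad := Pt
  rbad := toPt _
  iso_nonempty_Dv _ _ := ⟨Iso.refl _⟩

/-- **IUTchIII:Thm1.5(iii)** (kurims p.49) the GLUE is inhabited over the witness frame with every identification
isomorphism the identity: the whole [IUTchIII] §1–§2 interface stack (`LogStripData`, `ThetaLinkData`,
`BiCoricData`, `ThetaMonoidData`, `ThetaCoricData` + the glue laws of `LatticeGlue`) is jointly satisfiable.
[claim: Mochizuki2012, status: disputed] -/
noncomputable def twoGlue : LatticeGlue twoFrame where
  logData := twoLog
  linkData := twoTheta
  biCoric := twoBiCoric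
  thetaMonoid := twoThetaMonoid
  coric := twoCoric
  fglRoute_iso := Iso.refl _
  fxmDeltaHT_iso := Iso.refl _
  dvDelta_iso := Iso.refl _
  fxmOfDv_iso := Iso.refl _
  fxmOfDv_dv_compat := by
    ext X
    change twoFrame.FxmToDv.map (𝟙 _) ≫ 𝟙 _ = 𝟙 _
    rw [CategoryTheory.Functor.map_id, Category.id_comp]
  fxmDeltaD_iso := Iso.refl _
  fglEnv_iso := Iso.refl _
  pilotEnv_iso := Iso.refl _

/-- **IUTchIII:Prop2.1(vi)** (kurims p.61) sanity: over the witness glue the Prop 2.1 (vi) natural isomorphism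
handed to abc-iut-c312-1 (`LatticeGlue.envNat`) is the identity at every `D`-Hodge theater.
[claim: Mochizuki2012, status: disputed] -/
theorem twoGlue_envNat_app (H : twoFrame.DHT) : (twoGlue.envNat.app H).hom = 𝟙 _ := rfl


end Witness

end Literature.IUT.LogThetaLattice
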